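import Literature.NumberTheory.ConnesConsani2021.QuasiInnerProductHankel
import Literature.NumberTheory.ConnesConsani2021.QuasiInnerGaussFactors
import HarnessLib

/-!
# Connes–Consani 2021 (JNT) §4.3, Theorem 4.4 (i) PROVED — `ρ_∞ρ_p` is quasi-inner and
# `(1 − 𝒫)κκ_p𝒫` is an infinitesimal of order `½`

LINE 1 — LABEL: RH-FREE corpus literature (s-number calculus of the three operators `ℰ_∞`, `ℰ_p`, `ℰ₀`
of Theorem 4.4 (ii); no positivity statement, no statement about zeros of `ζ`); bears_on: W-C/W-P (P5
sequel vocabulary, no leaf role); WHAT THIS IS NOT: any claim about RH — nothing in this file bears on the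
truth of RH.

Source: A. Connes, C. Consani, *Quasi-inner functions and local factors*, J. Number Theory **226**
(2021) 139–167 = arXiv:2008.10974 [bib: `ConnesConsani2021QuasiInner`], Theorem 4.4 (i) (arXiv chunk
p0011:L89: «The function `ρ_∞(z)ρ_p(z)` is quasi-inner … The off diagonal part is an infinitesimal of
order `½`») and its proof (p0012:L19–L21: «the strong convergence still holds since the terms
`ρ_∞(2πin/log p)` tend to zero when `|n| → ∞` … by (uinfty2), `|ρ_∞(2πin/log p)|` is `O(|n|^{−1/2})`.
Thus we get that `D` is an infinitesimal of order `½` and so is `ℰ_p`»). THEOREMS ONLY.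

In the tree Theorem 4.4 (i) was so far the conditional `thm_4_4_i (h8 : thm_4_8)`; here it is proved
outright from Theorem 4.4 (ii) (`thm_4_4_ii_holds`, `QuasiInnerProductHankel.lean`):
`(1 − 𝒫)κκ_p𝒫 = ℰ_∞ + ((1−p)/p)U₋VDIV*U₊* + ℰ₀` with `V` from Lemmas 3.3–3.4 (`lemma_3_3_holds`,
`lemma_3_4_holds`), `I` the involution `δ_n ↦ δ_{−n}` and `D` the diagonal `Dδ_n = ρ_∞(2πin/log p)δ_n`
(`n ≠ 0`), `Dδ_0 = 0`, both constructed here on `ℓ²(ℤ)`; then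
* `ℰ_∞` is of infinite order (norm-convergent rank-one series with factorially decaying coefficients —
  the printed argument of Theorem 2.1, p0005:L128–L136),
* `D` is of order `½` because `|ρ_∞(2πin/log p)| = O(|n|^{−1/2})` (Lemma 4.3, t18's `norm_rhoArch_mul_I`)
  — an explicit truncation estimate `μ_{2N+1}(D) ≤ sup_{|n|>N}|d_n|` — hence so is `ℰ_p` (two-sided
  ideal, `IsInfinitesimalOfOrder.comp_comp`),
* `ℰ₀` has finite rank,
so the sum is of order `½` (`IsInfinitesimalOfOrder.add`), in particular compact, and `κκ_p` is
unimodular on `S¹`: `ρ_∞ρ_p` is quasi-inner relative to `ℂ₋`.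

* `isInfiniteOrder_of_hasSum_rankOne` — fast rank-one series are of infinite order.
* `isCompactOperator_of_isInfinitesimalOfOrder` — order `α > 0` ⇒ compact.
* `isInfinitesimalOfOrder_of_diag` — a diagonal operator on `ℓ²(ℤ)` with `|d_n| ≤ C(|n|+1)^{−α}` is of
  order `α`.
* `exists_norm_rhoArch_primePole_le` — `|ρ_∞(2πin/log p)| ≤ C(|n|+1)^{−1/2}`.
* `thm_4_4_i_unconditional` — **Theorem 4.4 (i) PROVED**.
* (append #1, inputs for Theorem 4.8) `IsInfinitesimalOfOrder.conj` (two-sided ideal across two spaces),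
  `isInfiniteOrder_of_hasSum_rankOne'` (weighted form), `exists_hankelData_rhoFactor` (the Hankel data of
  `κ^{(m,k)} = ρ_∞^{(m,k)} ∘ ψ`: nodes `x_n = ψ⁻¹(−2k−2mn)`, coefficients `c_n = −8r_n/(2p_n−3)²`),
  `hasSum_hardyOffDiag_rhoFactor`, `isInfiniteOrder_hardyOffDiag_rhoFactor` — `(1 − 𝒫)κ^{(m,k)}𝒫` is an
  infinitesimal of infinite order (Lemma 4.7: «the results of Section 2 continue to hold»).

Nothing in this file bears on the truth of RH.
-/

noncomputable section

open _root_.MeasureTheory _root_.Complex AddCircle Filter Set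
open scoped Real Topology Nat InnerProductSpace ComplexConjugate ENNReal

namespace Literature.NumberTheory.ConnesConsani2021

namespace QuasiInner

/-! ### A. s-number calculus: rank-one series, order versus compactness -/

section SNumbers

variable {H : Type*} [NormedAddCommGroup H] [InnerProductSpace ℂ H]

/-- RH-FREE. A sum of `#s` rank-one operators has rank `≤ #s`. [folklore] -/
private theorem po_rank_sum_rankOne_le {ι : Type*} (s : Finset ι) (c : ι → ℂ) (x y : ι → H) :
    Module.rank ℂ (LinearMap.range
      ((∑ i ∈ s, c i • InnerProductSpace.rankOne ℂ (x i) (y i) : H →L[ℂ] H) : H →ₗ[ℂ] H)) ≤ s.card := by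
  classical
  set t : Finset H := s.image x with ht
  have hsub : LinearMap.range
      ((∑ i ∈ s, c i • InnerProductSpace.rankOne ℂ (x i) (y i) : H →L[ℂ] H) : H →ₗ[ℂ] H) ≤
      Submodule.span ℂ (t : Set H) := by
    rintro _ ⟨v, rfl⟩
    rw [ContinuousLinearMap.coe_coe, FunLike.coe_sum, Finset.sum_apply]
    refine Submodule.sum_mem _ fun n hn => ?_
    rw [FunLike.coe_smul, Pi.smul_apply, InnerProductSpace.rankOne_apply]
    refine Submodule.smul_mem _ _ (Submodule.smul_mem _ _ (Submodule.subset_span ?_))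
    rw [ht, Finset.coe_image]
    exact ⟨n, Finset.mem_coe.mpr hn, rfl⟩
  have hcard : Module.rank ℂ (Submodule.span ℂ (t : Set H)) ≤ (t.card : Cardinal) := rank_span_finset_le t
  have hc3 : (t.card : Cardinal) ≤ (s.card : Cardinal) := by
    rw [ht]; exact_mod_cast Finset.card_image_le
  exact (Submodule.rank_mono hsub).trans (hcard.trans hc3)

variable [CompleteSpace H]

/-- RH-FREE. **A norm-convergent rank-one series with rapidly decaying coefficients is of infinite
order**: if `T = Σ_n c_n|x_n⟩⟨y_n|` with `‖x_n‖, ‖y_n‖ ≤ 1` and `Σ_n |c_n|(n+1)^k < ∞` for every `k`, then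
`μ_N(T)(N+1)^k ≤ Σ_n |c_n|(n+1)^k` (the `N`-th partial sum has rank `≤ N`, the remainder has norm
`≤ Σ_{n≥N}|c_n|`) — the printed argument «imposing `m` linear conditions … reduces the sum to [a tail]
whose norm is … `O(m^{−N})` for any `N`». [cite: ConnesConsani2021QuasiInner, Thm 2.1 proof (arXiv chunk p0005:L128–L136)] -/
theorem isInfiniteOrder_of_hasSum_rankOne {c : ℕ → ℂ} {x y : ℕ → H} (hx : ∀ n, ‖x n‖ ≤ 1)
    (hy : ∀ n, ‖y n‖ ≤ 1) (hc : ∀ k : ℕ, Summable fun n => ‖c n‖ * ((n : ℝ) + 1) ^ k)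
    {T : H →L[ℂ] H} (hT : HasSum (fun n => c n • InnerProductSpace.rankOne ℂ (x n) (y n)) T) :
    IsInfiniteOrder T := by
  refine IsInfiniteOrder.of_approx fun k => ⟨∑' n, ‖c n‖ * ((n : ℝ) + 1) ^ k, fun N => ?_⟩
  refine ⟨∑ n ∈ Finset.range N, c n • InnerProductSpace.rankOne ℂ (x n) (y n),
    (po_rank_sum_rankOne_le _ c x y).trans (by rw [Finset.card_range]), ?_⟩
  have hNpos : (0 : ℝ) < (N : ℝ) + 1 := by positivity
  -- the tail
  have htail : HasSum (fun n => c (n + N) • InnerProductSpace.rankOne ℂ (x (n + N)) (y (n + N)))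
      (T - ∑ n ∈ Finset.range N, c n • InnerProductSpace.rankOne ℂ (x n) (y n)) :=
    (hasSum_nat_add_iff' N).2 hT
  have hck := hc k
  have hshift : Summable fun n => ‖c (n + N)‖ * (((n + N : ℕ) : ℝ) + 1) ^ k :=
    (summable_nat_add_iff N).2 hck
  set g : ℕ → ℝ := fun n => ‖c (n + N)‖ * (((n + N : ℕ) : ℝ) + 1) ^ k / ((N : ℝ) + 1) ^ k with hg
  have hgsum : HasSum g ((∑' n, ‖c (n + N)‖ * (((n + N : ℕ) : ℝ) + 1) ^ k) / ((N : ℝ) + 1) ^ k) :=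
    hshift.hasSum.div_const _
  have hle : ∀ n, ‖c (n + N) • InnerProductSpace.rankOne ℂ (x (n + N)) (y (n + N))‖ ≤ g n := by
    intro n
    rw [norm_smul, InnerProductSpace.norm_rankOne, hg]
    have h1 : ‖x (n + N)‖ * ‖y (n + N)‖ ≤ 1 := by
      calc ‖x (n + N)‖ * ‖y (n + N)‖ ≤ 1 * 1 :=
            mul_le_mul (hx _) (hy _) (norm_nonneg _) zero_le_one
        _ = 1 := one_mul _
    have h2 : (1 : ℝ) ≤ (((n + N : ℕ) : ℝ) + 1) ^ k / ((N : ℝ) + 1) ^ k := by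
      rw [le_div_iff₀ (by positivity), one_mul]
      exact pow_le_pow_left₀ hNpos.le (by push_cast; linarith [(n.cast_nonneg : (0 : ℝ) ≤ n)]) k
    calc ‖c (n + N)‖ * (‖x (n + N)‖ * ‖y (n + N)‖) ≤ ‖c (n + N)‖ * 1 :=
          mul_le_mul_of_nonneg_left h1 (norm_nonneg _)
      _ ≤ ‖c (n + N)‖ * ((((n + N : ℕ) : ℝ) + 1) ^ k / ((N : ℝ) + 1) ^ k) :=
          mul_le_mul_of_nonneg_left h2 (norm_nonneg _)
      _ = ‖c (n + N)‖ * (((n + N : ℕ) : ℝ) + 1) ^ k / ((N : ℝ) + 1) ^ k := by ring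
  have hnorm := htail.norm_le_of_bounded hgsum hle
  -- the shifted sum is at most the full sum
  have htail_le : (∑' n, ‖c (n + N)‖ * (((n + N : ℕ) : ℝ) + 1) ^ k) ≤ ∑' n, ‖c n‖ * ((n : ℝ) + 1) ^ k := by
    have h := hck.sum_add_tsum_nat_add N
    have h0 : 0 ≤ ∑ i ∈ Finset.range N, ‖c i‖ * ((i : ℝ) + 1) ^ k :=
      Finset.sum_nonneg fun i _ => by positivity
    linarith [h]
  calc ‖T - ∑ n ∈ Finset.range N, c n • InnerProductSpace.rankOne ℂ (x n) (y n)‖ * ((N : ℝ) + 1) ^ k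
      ≤ (∑' n, ‖c (n + N)‖ * (((n + N : ℕ) : ℝ) + 1) ^ k) / ((N : ℝ) + 1) ^ k * ((N : ℝ) + 1) ^ k :=
        mul_le_mul_of_nonneg_right hnorm (by positivity)
    _ = ∑' n, ‖c (n + N)‖ * (((n + N : ℕ) : ℝ) + 1) ^ k := by
        field_simp
    _ ≤ ∑' n, ‖c n‖ * ((n : ℝ) + 1) ^ k := htail_le

end SNumbers

section Compact

variable {H : Type*} [NormedAddCommGroup H] [NormedSpace ℂ H] [CompleteSpace H]

omit [CompleteSpace H] in
/-- RH-FREE. A finite-rank bounded operator is compact. [folklore] -/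
private theorem po_isCompactOperator_of_rank_le {F : H →L[ℂ] H} {n : ℕ}
    (hF : Module.rank ℂ (LinearMap.range (F : H →ₗ[ℂ] H)) ≤ n) : IsCompactOperator F := by
  haveI : Module.Finite ℂ (LinearMap.range (F : H →ₗ[ℂ] H)) :=
    Module.rank_lt_aleph0_iff.1 (lt_of_le_of_lt hF (Cardinal.natCast_lt_aleph0 (n := n)))
  haveI : ProperSpace (LinearMap.range (F : H →ₗ[ℂ] H)) := FiniteDimensional.proper_rclike ℂ _
  have h1 : IsCompactOperator (F.codRestrict (LinearMap.range (F : H →ₗ[ℂ] H))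
      (fun x => LinearMap.mem_range_self _ x)) :=
    isCompactOperator_of_locallyCompactSpace_dom
      (F.codRestrict (LinearMap.range (F : H →ₗ[ℂ] H)) (fun x => LinearMap.mem_range_self _ x))
  exact h1.continuous_comp (Submodule.subtypeL (LinearMap.range (F : H →ₗ[ℂ] H))).continuous

/-- RH-FREE. **An infinitesimal of order `α > 0` is a compact operator** (`μ_n(T) → 0`: `T` is a norm
limit of finite-rank operators). [cite: Connes1994, Introduction, quantized-calculus dictionary «infinitesimals of order α» (cf. Chap. IV §2)] -/
theorem isCompactOperator_of_isInfinitesimalOfOrder {T : H →L[ℂ] H} {α : ℝ}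
    (hα : 0 < α) (h : IsInfinitesimalOfOrder T α) : IsCompactOperator T := by
  obtain ⟨C, hC⟩ := h
  have hF : ∀ n : ℕ, ∃ F : H →L[ℂ] H, Module.rank ℂ (LinearMap.range (F : H →ₗ[ℂ] H)) ≤ n ∧
      ‖T - F‖ < approxNumber T n + 1 / ((n : ℝ) + 1) := fun n =>
    exists_rank_le_norm_sub_lt T n (by positivity)
  choose F hFr hFn using hF
  have hμ : ∀ n : ℕ, approxNumber T n ≤ C * ((n : ℝ) + 1) ^ (-α) := by
    intro n
    have hpos : (0 : ℝ) < ((n : ℝ) + 1) ^ α := Real.rpow_pos_of_pos (by positivity) α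
    rw [Real.rpow_neg (by positivity), ← div_eq_mul_inv, le_div_iff₀ hpos]
    exact hC n
  have hlim : Tendsto (fun n => F n) atTop (𝓝 T) := by
    rw [tendsto_iff_norm_sub_tendsto_zero]
    have h0 : Tendsto (fun n : ℕ => C * ((n : ℝ) + 1) ^ (-α) + 1 / ((n : ℝ) + 1)) atTop (𝓝 0) := by
      have h1 : Tendsto (fun n : ℕ => ((n : ℝ) + 1) ^ (-α)) atTop (𝓝 0) :=
        (tendsto_rpow_neg_atTop hα).comp
          (tendsto_atTop_add_const_right atTop 1 tendsto_natCast_atTop_atTop)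
      have h2 : Tendsto (fun n : ℕ => 1 / ((n : ℝ) + 1)) atTop (𝓝 0) :=
        tendsto_one_div_add_atTop_nhds_zero_nat
      simpa using (h1.const_mul C).add h2
    refine squeeze_zero (fun n => norm_nonneg _) (fun n => ?_) h0
    rw [norm_sub_rev]
    exact (hFn n).le.trans (by linarith [hμ n])
  exact isCompactOperator_of_tendsto hlim
    (Eventually.of_forall fun n => po_isCompactOperator_of_rank_le (hFr n))

omit [CompleteSpace H] in
/-- RH-FREE. Scalar multiples keep the order. [cite: Connes1994, Introduction, quantized-calculus dictionary] -/
private theorem po_order_smul {T : H →L[ℂ] H} {α : ℝ} (h : IsInfinitesimalOfOrder T α)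
    (c : ℂ) : IsInfinitesimalOfOrder (c • T) α := by
  have h1 := h.comp_left (c • (1 : H →L[ℂ] H))
  have e : (c • (1 : H →L[ℂ] H)).comp T = c • T := by
    ext v; simp
  rwa [e] at h1

end Compact

section Conj

universe u

variable {E F : Type u} [NormedAddCommGroup E] [NormedSpace ℂ E] [NormedAddCommGroup F] [NormedSpace ℂ F]

/-- RH-FREE. `μ_n(ATB) ≤ ‖A‖μ_n(T)‖B‖` for bounded `A : E → F`, `B : F → E` (two-sided ideal across two
spaces). [cite: Connes1994, Introduction, quantized-calculus dictionary («they form a two-sided ideal»)] -/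
private theorem po_approxNumber_conj_le (A : E →L[ℂ] F) (T : E →L[ℂ] E) (B : F →L[ℂ] E) (n : ℕ) :
    approxNumber (A ∘L T ∘L B) n ≤ ‖A‖ * approxNumber T n * ‖B‖ := by
  refine le_of_forall_pos_lt_add fun ε hε => ?_
  have hAB : 0 ≤ ‖A‖ * ‖B‖ := by positivity
  obtain ⟨G, hG, hTG⟩ := exists_rank_le_norm_sub_lt T n (ε := ε / (‖A‖ * ‖B‖ + 1)) (by positivity)
  have hrank : Module.rank ℂ (LinearMap.range ((A ∘L G ∘L B : F →L[ℂ] F) : F →ₗ[ℂ] F)) ≤ n := by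
    have e : ((A ∘L G ∘L B : F →L[ℂ] F) : F →ₗ[ℂ] F) =
        (A : E →ₗ[ℂ] F) ∘ₗ ((G : E →ₗ[ℂ] E) ∘ₗ (B : F →ₗ[ℂ] E)) := rfl
    rw [e]
    calc Module.rank ℂ (LinearMap.range ((A : E →ₗ[ℂ] F) ∘ₗ ((G : E →ₗ[ℂ] E) ∘ₗ (B : F →ₗ[ℂ] E))))
        ≤ Module.rank ℂ (LinearMap.range ((G : E →ₗ[ℂ] E) ∘ₗ (B : F →ₗ[ℂ] E))) :=
          LinearMap.rank_comp_le_right _ _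
      _ ≤ Module.rank ℂ (LinearMap.range (G : E →ₗ[ℂ] E)) := LinearMap.rank_comp_le_left _ _
      _ ≤ n := hG
  have hnorm : ‖A ∘L T ∘L B - A ∘L G ∘L B‖ ≤ ‖A‖ * ‖T - G‖ * ‖B‖ := by
    have e : A ∘L T ∘L B - A ∘L G ∘L B = A ∘L (T - G) ∘L B := by
      rw [ContinuousLinearMap.sub_comp, ContinuousLinearMap.comp_sub]
    rw [e]
    calc ‖A ∘L (T - G) ∘L B‖ ≤ ‖A‖ * ‖(T - G) ∘L B‖ := ContinuousLinearMap.opNorm_comp_le _ _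
      _ ≤ ‖A‖ * (‖T - G‖ * ‖B‖) :=
          mul_le_mul_of_nonneg_left (ContinuousLinearMap.opNorm_comp_le _ _) (norm_nonneg _)
      _ = ‖A‖ * ‖T - G‖ * ‖B‖ := by ring
  have hfrac : ‖A‖ * ‖B‖ / (‖A‖ * ‖B‖ + 1) < 1 := by
    rw [div_lt_one (by positivity)]; linarith
  calc approxNumber (A ∘L T ∘L B) n ≤ ‖A ∘L T ∘L B - A ∘L G ∘L B‖ := approxNumber_le_of_rank_le _ _ hrank
    _ ≤ ‖A‖ * ‖T - G‖ * ‖B‖ := hnorm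
    _ ≤ ‖A‖ * (approxNumber T n + ε / (‖A‖ * ‖B‖ + 1)) * ‖B‖ :=
        mul_le_mul_of_nonneg_right (mul_le_mul_of_nonneg_left hTG.le (norm_nonneg _)) (norm_nonneg _)
    _ = ‖A‖ * approxNumber T n * ‖B‖ + ε * (‖A‖ * ‖B‖ / (‖A‖ * ‖B‖ + 1)) := by
        field_simp
    _ < ‖A‖ * approxNumber T n * ‖B‖ + ε * 1 := by gcongr
    _ = ‖A‖ * approxNumber T n * ‖B‖ + ε := by rw [mul_one]

/-- RH-FREE. **Two-sided ideal across two spaces**: `ATB` is of order `α` on `F` when `T` is of order `α`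
on `E`. [cite: Connes1994, Introduction, quantized-calculus dictionary («they form a two-sided ideal»)] -/
private theorem po_order_conj {T : E →L[ℂ] E} {α : ℝ} (h : IsInfinitesimalOfOrder T α)
    (A : E →L[ℂ] F) (B : F →L[ℂ] E) : IsInfinitesimalOfOrder (A ∘L T ∘L B) α := by
  obtain ⟨C, hC⟩ := h
  refine ⟨‖A‖ * ‖B‖ * C, fun n => ?_⟩
  have hpow : 0 ≤ ((n : ℝ) + 1) ^ α := Real.rpow_nonneg (by positivity) α
  calc approxNumber (A ∘L T ∘L B) n * ((n : ℝ) + 1) ^ α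
      ≤ (‖A‖ * approxNumber T n * ‖B‖) * ((n : ℝ) + 1) ^ α :=
        mul_le_mul_of_nonneg_right (po_approxNumber_conj_le A T B n) hpow
    _ = ‖A‖ * ‖B‖ * (approxNumber T n * ((n : ℝ) + 1) ^ α) := by ring
    _ ≤ ‖A‖ * ‖B‖ * C := mul_le_mul_of_nonneg_left (hC n) (by positivity)

end Conj

/-! ### B. Operators on `ℓ²(ℤ)`: the involution `I` and diagonal operators -/

section EllTwo

/-- RH-FREE. The involution `I : ℓ²(ℤ) → ℓ²(ℤ)`, `I(δ_n) = δ_{−n}`, exists as a bounded operator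
(`(If)(n) = f(−n)`). [cite: ConnesConsani2021QuasiInner, Lemma 3.5 (arXiv chunk p0008:L131)] -/
theorem exists_lpInvolution :
    ∃ Iop : lp (fun _ : ℤ => ℂ) 2 →L[ℂ] lp (fun _ : ℤ => ℂ) 2,
      ∀ n : ℤ, Iop (lp.single 2 n (1 : ℂ)) = lp.single 2 (-n) (1 : ℂ) := by
  have h2 : (0 : ℝ) < (2 : ℝ≥0∞).toReal := by norm_num
  have hmem : ∀ f : lp (fun _ : ℤ => ℂ) 2, Memℓp (fun n : ℤ => f (-n)) 2 := by
    intro f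
    have hs : Summable fun n : ℤ => ‖f n‖ ^ (2 : ℝ≥0∞).toReal := (lp.memℓp f).summable h2
    rw [memℓp_gen_iff h2]
    exact (Equiv.neg ℤ).summable_iff.2 hs
  let L : lp (fun _ : ℤ => ℂ) 2 →ₗ[ℂ] lp (fun _ : ℤ => ℂ) 2 :=
    { toFun := fun f => ⟨fun n => f (-n), hmem f⟩
      map_add' := fun f g => lp.ext (funext fun n =>
        show (f + g) (-n) = f (-n) + g (-n) from by rw [lp.coeFn_add, Pi.add_apply])
      map_smul' := fun c f => lp.ext (funext fun n =>
        show (c • f) (-n) = c • f (-n) from by rw [lp.coeFn_smul, Pi.smul_apply]) }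
  have hbound : ∀ f, ‖L f‖ ≤ 1 * ‖f‖ := by
    intro f
    rw [one_mul]
    refine lp.norm_le_of_tsum_le h2 (norm_nonneg _) ?_
    rw [lp.norm_rpow_eq_tsum h2 f]
    have e : (fun n : ℤ => ‖(L f) n‖ ^ (2 : ℝ≥0∞).toReal) =
        fun n => ‖f ((Equiv.neg ℤ) n)‖ ^ (2 : ℝ≥0∞).toReal := rfl
    rw [e, Equiv.tsum_eq (Equiv.neg ℤ) (fun n => ‖f n‖ ^ (2 : ℝ≥0∞).toReal)]
  refine ⟨L.mkContinuous 1 hbound, fun n => ?_⟩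
  have key : ∀ j : ℤ, (lp.single 2 n (1 : ℂ) : ∀ i : ℤ, (fun _ : ℤ => ℂ) i) (-j) =
      (lp.single 2 (-n) (1 : ℂ) : ∀ i : ℤ, (fun _ : ℤ => ℂ) i) j := by
    intro j
    simp only [lp.coeFn_single, Pi.single_apply]
    by_cases h : j = -n
    · subst h; simp
    · rw [if_neg h, if_neg (fun h' => h (by rw [← h']; ring))]
  exact lp.ext (funext key)

/-- RH-FREE. The diagonal operator `δ_n ↦ d_n δ_n` of a bounded sequence exists as a bounded operator on
`ℓ²(ℤ)`. [cite: ConnesConsani2021QuasiInner, Thm 4.4 (ii) (arXiv chunk p0011:L98) «D(δ_n) := ρ_∞(2πin/log p)δ_n»] -/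
theorem exists_lpDiagonal {d : ℤ → ℂ} {C : ℝ} (hd : ∀ n, ‖d n‖ ≤ C) :
    ∃ Dop : lp (fun _ : ℤ => ℂ) 2 →L[ℂ] lp (fun _ : ℤ => ℂ) 2,
      ∀ n : ℤ, Dop (lp.single 2 n (1 : ℂ)) = d n • lp.single 2 n (1 : ℂ) := by
  have h2 : (0 : ℝ) < (2 : ℝ≥0∞).toReal := by norm_num
  have hC : 0 ≤ C := (norm_nonneg _).trans (hd 0)
  have hmem : ∀ f : lp (fun _ : ℤ => ℂ) 2, Memℓp (fun n : ℤ => d n * f n) 2 := by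
    intro f
    have hs : Summable fun n : ℤ => ‖f n‖ ^ (2 : ℝ≥0∞).toReal := (lp.memℓp f).summable h2
    rw [memℓp_gen_iff h2]
    simp only [ENNReal.toReal_ofNat] at hs ⊢
    refine Summable.of_nonneg_of_le (fun n => by positivity) (fun n => ?_) (hs.mul_left (C ^ 2))
    rw [norm_mul, Real.mul_rpow (norm_nonneg _) (norm_nonneg _), Real.rpow_two]
    exact mul_le_mul_of_nonneg_right (pow_le_pow_left₀ (norm_nonneg _) (hd n) 2) (by positivity)
  let L : lp (fun _ : ℤ => ℂ) 2 →ₗ[ℂ] lp (fun _ : ℤ => ℂ) 2 :=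
    { toFun := fun f => ⟨fun n => d n * f n, hmem f⟩
      map_add' := fun f g => lp.ext (funext fun n =>
        show d n * (f + g) n = d n * f n + d n * g n from by
          rw [lp.coeFn_add, Pi.add_apply, mul_add])
      map_smul' := fun c f => lp.ext (funext fun n =>
        show d n * (c • f) n = c • (d n * f n) from by
          rw [lp.coeFn_smul, Pi.smul_apply, smul_eq_mul, smul_eq_mul, mul_left_comm]) }
  have hbound : ∀ f, ‖L f‖ ≤ C * ‖f‖ := by
    intro f
    refine lp.norm_le_of_tsum_le h2 (by positivity) ?_
    have hx : HasSum (fun n : ℤ => ‖f n‖ ^ (2 : ℝ)) (‖f‖ ^ (2 : ℝ)) := by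
      have h := lp.hasSum_norm h2 f
      simpa using h
    simp only [ENNReal.toReal_ofNat]
    have hle : ∀ n : ℤ, ‖(L f) n‖ ^ (2 : ℝ) ≤ C ^ 2 * ‖f n‖ ^ (2 : ℝ) := fun n => by
      show ‖d n * f n‖ ^ (2 : ℝ) ≤ _
      rw [norm_mul, Real.mul_rpow (norm_nonneg _) (norm_nonneg _), Real.rpow_two]
      exact mul_le_mul_of_nonneg_right (pow_le_pow_left₀ (norm_nonneg _) (hd n) 2) (by positivity)
    have hsum : Summable fun n : ℤ => ‖(L f) n‖ ^ (2 : ℝ) := by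
      have h := (lp.memℓp (L f)).summable h2
      simpa using h
    calc ∑' n, ‖(L f) n‖ ^ (2 : ℝ) ≤ ∑' n, C ^ 2 * ‖f n‖ ^ (2 : ℝ) :=
          hsum.tsum_le_tsum hle (hx.summable.mul_left _)
      _ = (C * ‖f‖) ^ (2 : ℝ) := by rw [(hx.mul_left _).tsum_eq, Real.rpow_two, Real.rpow_two]; ring
  refine ⟨L.mkContinuous C hbound, fun n => ?_⟩
  have key : ∀ j : ℤ, d j * (lp.single 2 n (1 : ℂ) : ∀ i : ℤ, (fun _ : ℤ => ℂ) i) j =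
      ((d n • lp.single 2 n (1 : ℂ) : lp (fun _ : ℤ => ℂ) 2) : ∀ i : ℤ, (fun _ : ℤ => ℂ) i) j := by
    intro j
    rw [lp.coeFn_smul, Pi.smul_apply, smul_eq_mul]
    simp only [lp.coeFn_single, Pi.single_apply]
    split_ifs with h
    · subst h; ring
    · ring
  exact lp.ext (funext key)

/-- RH-FREE. The coordinates of `Df` for a bounded `D` acting diagonally on the basis: `(Df)(j) = d_j f(j)`.
[folklore] -/
private theorem po_diag_apply {D : lp (fun _ : ℤ => ℂ) 2 →L[ℂ] lp (fun _ : ℤ => ℂ) 2} {d : ℤ → ℂ}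
    (hD : ∀ n : ℤ, D (lp.single 2 n (1 : ℂ)) = d n • lp.single 2 n (1 : ℂ))
    (f : lp (fun _ : ℤ => ℂ) 2) (j : ℤ) : D f j = d j * f j := by
  classical
  have hf : HasSum (fun n : ℤ => lp.single (E := fun _ : ℤ => ℂ) 2 n ((f : ∀ i : ℤ, (fun _ : ℤ => ℂ) i) n)) f :=
    lp.hasSum_single (by norm_num) f
  have key : ∀ n : ℤ, lp.single (E := fun _ : ℤ => ℂ) 2 n ((f : ∀ i : ℤ, (fun _ : ℤ => ℂ) i) n) =
      ((f : ∀ i : ℤ, (fun _ : ℤ => ℂ) i) n) • lp.single (E := fun _ : ℤ => ℂ) 2 n (1 : ℂ) := by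
    intro n
    refine lp.ext (funext fun i => ?_)
    rw [lp.coeFn_smul, Pi.smul_apply, smul_eq_mul]
    simp only [lp.coeFn_single, Pi.single_apply]
    split_ifs <;> simp
  have hf' : HasSum (fun n : ℤ => ((f : ∀ i : ℤ, (fun _ : ℤ => ℂ) i) n) • lp.single 2 n (1 : ℂ)) f := by
    simpa only [key] using hf
  have hDf := D.hasSum hf'
  simp only [map_smul, hD, smul_smul] at hDf
  have hcoord : ∀ g : lp (fun _ : ℤ => ℂ) 2, ⟪lp.single 2 j (1 : ℂ), g⟫_ℂ = g j := by
    intro g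
    rw [lp.inner_single_left]
    simp
  have h := (innerSL ℂ (lp.single 2 j (1 : ℂ))).hasSum hDf
  simp only [innerSL_apply_apply, hcoord] at h
  have h2 : HasSum (fun n : ℤ => (f : ∀ i : ℤ, (fun _ : ℤ => ℂ) i) n * d n *
      (lp.single 2 n (1 : ℂ) : ∀ i : ℤ, (fun _ : ℤ => ℂ) i) j) (d j * (f : ∀ i : ℤ, (fun _ : ℤ => ℂ) i) j) := by
    convert hasSum_ite_eq j (d j * (f : ∀ i : ℤ, (fun _ : ℤ => ℂ) i) j) using 1
    funext n
    simp only [lp.coeFn_single, Pi.single_apply]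
    by_cases h1 : n = j
    · subst h1; simp only [if_true]; ring
    · rw [if_neg h1, if_neg (fun h' => h1 h'.symm), mul_zero]
  exact h.unique h2

/-- RH-FREE. **A diagonal operator with `|d_n| ≤ C(|n|+1)^{−α}` is an infinitesimal of order `α`**
(`μ_{2N+1}(D) ≤ ‖D − D1_{|n|≤N}‖ ≤ sup_{|n|>N}|d_n|`): the step «by (uinfty2), `|ρ_∞(2πin/log p)|` is
`O(|n|^{−1/2})`. Thus we get that `D` is an infinitesimal of order `½`» for a general exponent, for ANY
bounded `D` acting diagonally on the basis `δ_n` (as typed in `thm_4_4_ii`).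
[cite: ConnesConsani2021QuasiInner, Thm 4.4 proof (arXiv chunk p0012:L19–L21); Connes1994, Chap. IV §2.α] -/
theorem isInfinitesimalOfOrder_of_diag {D : lp (fun _ : ℤ => ℂ) 2 →L[ℂ] lp (fun _ : ℤ => ℂ) 2}
    {d : ℤ → ℂ} (hD : ∀ n : ℤ, D (lp.single 2 n (1 : ℂ)) = d n • lp.single 2 n (1 : ℂ))
    {C α : ℝ} (hα : 0 ≤ α) (hd : ∀ n : ℤ, ‖d n‖ ≤ C * ((|n| : ℝ) + 1) ^ (-α)) :
    IsInfinitesimalOfOrder D α := by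
  classical
  have h2 : (0 : ℝ) < (2 : ℝ≥0∞).toReal := by norm_num
  have hC : 0 ≤ C := by
    have h := hd 0
    simp only [Int.cast_zero, abs_zero, zero_add, Real.one_rpow, mul_one] at h
    exact (norm_nonneg _).trans h
  -- truncations
  set S : ℕ → Finset ℤ := fun N => Finset.Icc (-(N : ℤ)) N with hS
  set F : ℕ → (lp (fun _ : ℤ => ℂ) 2 →L[ℂ] lp (fun _ : ℤ => ℂ) 2) := fun N =>
    ∑ n ∈ S N, d n • InnerProductSpace.rankOne ℂ (lp.single 2 n (1 : ℂ)) (lp.single 2 n (1 : ℂ)) with hF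
  have hcoord1 : ∀ g : lp (fun _ : ℤ => ℂ) 2, ∀ n : ℤ, ⟪lp.single 2 n (1 : ℂ), g⟫_ℂ = g n := by
    intro g n
    rw [lp.inner_single_left]
    simp
  have hcoordF : ∀ N f j, F N f j = if j ∈ S N then d j * f j else 0 := by
    intro N f j
    rw [hF]
    simp only [FunLike.coe_sum, Finset.sum_apply, FunLike.coe_smul, Pi.smul_apply,
      InnerProductSpace.rankOne_apply, hcoord1, lp.coeFn_sum, lp.coeFn_smul,
      lp.coeFn_single, Pi.single_apply, smul_eq_mul, mul_ite, mul_one, mul_zero]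
    exact Finset.sum_ite_eq (S N) j _
  have hcoordD : ∀ f j, D f j = d j * f j := po_diag_apply hD
  -- the norm of `D − F N`
  have htail : ∀ N : ℕ, ‖D - F N‖ ≤ C * ((N : ℝ) + 2) ^ (-α) := by
    intro N
    have hs0 : 0 ≤ C * ((N : ℝ) + 2) ^ (-α) := mul_nonneg hC (Real.rpow_nonneg (by positivity) _)
    refine ContinuousLinearMap.opNorm_le_bound _ hs0 fun f => ?_
    refine lp.norm_le_of_tsum_le h2 (by positivity) ?_
    have hx : HasSum (fun n : ℤ => ‖f n‖ ^ (2 : ℝ)) (‖f‖ ^ (2 : ℝ)) := by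
      have h := lp.hasSum_norm h2 f
      simpa using h
    simp only [ENNReal.toReal_ofNat]
    have hle : ∀ j : ℤ, ‖(D - F N) f j‖ ^ (2 : ℝ) ≤
        (C * ((N : ℝ) + 2) ^ (-α)) ^ 2 * ‖f j‖ ^ (2 : ℝ) := by
      intro j
      simp only [_root_.sub_apply, lp.coeFn_sub, Pi.sub_apply, hcoordD, hcoordF]
      by_cases hj : j ∈ S N
      · rw [if_pos hj, sub_self, norm_zero, Real.zero_rpow (by norm_num)]
        positivity
      · rw [if_neg hj, sub_zero, norm_mul, Real.mul_rpow (norm_nonneg _) (norm_nonneg _), Real.rpow_two]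
        refine mul_le_mul_of_nonneg_right ?_ (by positivity)
        refine pow_le_pow_left₀ (norm_nonneg _) ((hd j).trans ?_) 2
        refine mul_le_mul_of_nonneg_left ?_ hC
        have hj' : (N : ℝ) + 2 ≤ (|j| : ℝ) + 1 := by
          rw [hS, Finset.mem_Icc, not_and_or, not_le, not_le] at hj
          have : (N : ℤ) + 1 ≤ |j| := by
            rcases hj with hj | hj
            · rw [abs_of_neg (by omega)]; omega
            · rw [abs_of_pos (by omega)]; omega
          have h' : ((N : ℤ) : ℝ) + 1 ≤ ((|j| : ℤ) : ℝ) := by exact_mod_cast this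
          push_cast at h'
          linarith
        exact Real.rpow_le_rpow_of_nonpos (by positivity) hj' (by linarith)
    have hsum : Summable fun j : ℤ => ‖(D - F N) f j‖ ^ (2 : ℝ) := by
      have h := (lp.memℓp ((D - F N) f)).summable h2
      simpa using h
    calc ∑' j, ‖(D - F N) f j‖ ^ (2 : ℝ) ≤ ∑' j, (C * ((N : ℝ) + 2) ^ (-α)) ^ 2 * ‖f j‖ ^ (2 : ℝ) :=
          hsum.tsum_le_tsum hle (hx.summable.mul_left _)
      _ = (C * ((N : ℝ) + 2) ^ (-α) * ‖f‖) ^ (2 : ℝ) := by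
          rw [(hx.mul_left _).tsum_eq, Real.rpow_two, Real.rpow_two]; ring
  -- ranks
  have hrank : ∀ N : ℕ, Module.rank ℂ (LinearMap.range ((F N : lp (fun _ : ℤ => ℂ) 2 →L[ℂ]
      lp (fun _ : ℤ => ℂ) 2) : lp (fun _ : ℤ => ℂ) 2 →ₗ[ℂ] lp (fun _ : ℤ => ℂ) 2)) ≤ (2 * N + 1 : ℕ) := by
    intro N
    refine (po_rank_sum_rankOne_le (S N) d _ _).trans ?_
    rw [hS, Int.card_Icc]
    exact_mod_cast (by omega : ((N : ℤ) + 1 - -(N : ℤ)).toNat ≤ 2 * N + 1)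
  -- conclusion
  refine ⟨C * (2 : ℝ) ^ α + ‖D‖, fun n => ?_⟩
  have h2α : 0 ≤ C * (2 : ℝ) ^ α := mul_nonneg hC (Real.rpow_nonneg (by norm_num) α)
  rcases Nat.eq_zero_or_pos n with hn | hn
  · subst hn
    simp only [Nat.cast_zero, zero_add, Real.one_rpow, mul_one]
    linarith [approxNumber_le_opNorm D 0]
  · set N : ℕ := (n - 1) / 2 with hN
    have hNn : 2 * N + 1 ≤ n := by omega
    have hnN : (n : ℝ) + 1 ≤ 2 * ((N : ℝ) + 2) := by
      have : n ≤ 2 * N + 2 := by omega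
      have h' : (n : ℝ) ≤ 2 * N + 2 := by exact_mod_cast this
      linarith
    have hμ : approxNumber D n ≤ C * ((N : ℝ) + 2) ^ (-α) :=
      (approxNumber_le_of_rank_le D (F N) ((hrank N).trans (by exact_mod_cast hNn))).trans (htail N)
    have hpow : ((n : ℝ) + 1) ^ α ≤ (2 : ℝ) ^ α * ((N : ℝ) + 2) ^ α := by
      rw [← Real.mul_rpow (by norm_num) (by positivity)]
      exact Real.rpow_le_rpow (by positivity) hnN hα
    have hN2 : (0 : ℝ) < (N : ℝ) + 2 := by positivity
    calc approxNumber D n * ((n : ℝ) + 1) ^ α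
        ≤ C * ((N : ℝ) + 2) ^ (-α) * ((2 : ℝ) ^ α * ((N : ℝ) + 2) ^ α) :=
          mul_le_mul hμ hpow (Real.rpow_nonneg (by positivity) α)
            (mul_nonneg hC (Real.rpow_nonneg hN2.le _))
      _ = C * (2 : ℝ) ^ α * (((N : ℝ) + 2) ^ (-α) * ((N : ℝ) + 2) ^ α) := by ring
      _ = C * (2 : ℝ) ^ α := by
          rw [← Real.rpow_add hN2, neg_add_cancel, Real.rpow_zero, mul_one]
      _ ≤ C * (2 : ℝ) ^ α + ‖D‖ := by linarith [norm_nonneg D]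

end EllTwo

/-! ### C. The decay `|ρ_∞(2πin/log p)| = O(|n|^{−1/2})` -/

section Decay

/-- RH-FREE. `coth x ≤ 1 + 1/x₀`-type bound: for `0 < x₀ ≤ x`, `cosh x / sinh x ≤ 1 + 1/x₀`
(`cosh x = sinh x + e^{−x}`, `e^{−x} ≤ 1`, `x ≤ sinh x`). [folklore] -/
private theorem po_coth_le {x₀ x : ℝ} (hx₀ : 0 < x₀) (hx : x₀ ≤ x) :
    Real.cosh x / Real.sinh x ≤ 1 + 1 / x₀ := by
  have hxpos : 0 < x := lt_of_lt_of_le hx₀ hx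
  have hsinh : 0 < Real.sinh x := Real.sinh_pos_iff.2 hxpos
  have hxs : x ≤ Real.sinh x := Real.self_le_sinh_iff.2 hxpos.le
  have hexp : Real.cosh x = Real.sinh x + Real.exp (-x) := by linarith [Real.cosh_sub_sinh x]
  have hex1 : Real.exp (-x) ≤ 1 := by rw [Real.exp_le_one_iff]; linarith
  have hkey : Real.exp (-x) ≤ (1 / x₀) * Real.sinh x := by
    rw [one_div, ← div_eq_inv_mul, le_div_iff₀ hx₀]
    calc Real.exp (-x) * x₀ ≤ 1 * x := mul_le_mul hex1 hx hx₀.le zero_le_one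
      _ = x := one_mul x
      _ ≤ Real.sinh x := hxs
  rw [div_le_iff₀ hsinh, hexp]
  nlinarith [hkey]

/-- RH-FREE. **`|ρ_∞(2πin/log p)| ≤ C(|n|+1)^{−1/2}` for `n ≠ 0`** («by (uinfty2), `|ρ_∞(2πin/log p)|` is
`O(|n|^{−1/2})`»: Lemma 4.3 `|ρ_∞(it)| = |t|^{−1/2}(2π coth(π|t|/2))^{1/2}`, t18's `norm_rhoArch_mul_I`,
with `coth x ≤ 1 + 1/x₀` for `x ≥ x₀ = π²/log p`). [cite: ConnesConsani2021QuasiInner, Thm 4.4 proof (arXiv chunk p0012:L20) with Lemma 4.3 (p0011:L69)] -/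
theorem exists_norm_rhoArch_primePole_le {p : ℕ} (hp : 1 < p) :
    ∃ C : ℝ, ∀ n : ℤ, n ≠ 0 →
      ‖rhoArch (2 * π * I * n / Real.log p)‖ ≤ C * ((|n| : ℝ) + 1) ^ (-(1 / 2 : ℝ)) := by
  have hL : 0 < Real.log p := Real.log_pos (by exact_mod_cast hp)
  set K : ℝ := 1 + 1 / (π ^ 2 / Real.log p) with hK
  have hKpos : 0 < K := by rw [hK]; positivity
  refine ⟨(2 * π / Real.log p) ^ (-(1 / 2 : ℝ)) * Real.sqrt 2 * Real.sqrt (2 * π * K), fun n hn => ?_⟩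
  set t : ℝ := 2 * π * n / Real.log p with ht
  have hn1 : (1 : ℝ) ≤ |(n : ℝ)| := by
    rw [← Int.cast_abs]; exact_mod_cast Int.one_le_abs hn
  have htabs : |t| = 2 * π / Real.log p * |(n : ℝ)| := by
    rw [ht, abs_div, abs_mul, abs_of_pos (by positivity : (0 : ℝ) < 2 * π), abs_of_pos hL]
    ring
  have hc0 : 0 < 2 * π / Real.log p := by positivity
  have htpos : 0 < |t| := by rw [htabs]; positivity
  have ht0 : t ≠ 0 := abs_pos.1 htpos
  have hz : (2 * π * I * n / Real.log p : ℂ) = (t : ℂ) * I := by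
    rw [ht]; push_cast; ring
  rw [hz, norm_rhoArch_mul_I t ht0]
  -- the `coth` factor
  have hx0 : π ^ 2 / Real.log p ≤ π * |t| / 2 := by
    rw [htabs]
    have e : π * (2 * π / Real.log p * |(n : ℝ)|) / 2 = π ^ 2 / Real.log p * |(n : ℝ)| := by
      ring
    rw [e]
    exact le_mul_of_one_le_right (by positivity) hn1
  have hcoth : Real.cosh (π * |t| / 2) / Real.sinh (π * |t| / 2) ≤ K :=
    po_coth_le (by positivity) hx0
  have hsq : Real.sqrt (2 * π * (Real.cosh (π * |t| / 2) / Real.sinh (π * |t| / 2))) ≤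
      Real.sqrt (2 * π * K) :=
    Real.sqrt_le_sqrt (by nlinarith [hcoth, Real.pi_pos])
  -- the power factor: `|n|^{−1/2} ≤ √2 (|n|+1)^{−1/2}` since `|n|+1 ≤ 2|n|`
  have hpow : |t| ^ (-(1 / 2 : ℝ)) ≤ (2 * π / Real.log p) ^ (-(1 / 2 : ℝ)) * Real.sqrt 2 *
      (|(n : ℝ)| + 1) ^ (-(1 / 2 : ℝ)) := by
    rw [htabs, Real.mul_rpow hc0.le (abs_nonneg _), mul_assoc]
    refine mul_le_mul_of_nonneg_left ?_ (Real.rpow_nonneg hc0.le _)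
    have h2n : (|(n : ℝ)| + 1) ≤ 2 * |(n : ℝ)| := by linarith
    have hA : (2 * |(n : ℝ)|) ^ (-(1 / 2 : ℝ)) ≤ (|(n : ℝ)| + 1) ^ (-(1 / 2 : ℝ)) :=
      Real.rpow_le_rpow_of_nonpos (by positivity) h2n (by norm_num)
    rw [Real.mul_rpow (by norm_num) (abs_nonneg _)] at hA
    have hs2 : Real.sqrt 2 * (2 : ℝ) ^ (-(1 / 2 : ℝ)) = 1 := by
      rw [Real.sqrt_eq_rpow, ← Real.rpow_add (by norm_num)]
      norm_num
    calc |(n : ℝ)| ^ (-(1 / 2 : ℝ))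
        = Real.sqrt 2 * ((2 : ℝ) ^ (-(1 / 2 : ℝ)) * |(n : ℝ)| ^ (-(1 / 2 : ℝ))) := by
          rw [← mul_assoc, hs2, one_mul]
      _ ≤ Real.sqrt 2 * (|(n : ℝ)| + 1) ^ (-(1 / 2 : ℝ)) :=
          mul_le_mul_of_nonneg_left hA (Real.sqrt_nonneg _)
  calc |t| ^ (-(1 / 2 : ℝ)) * Real.sqrt (2 * π * (Real.cosh (π * |t| / 2) / Real.sinh (π * |t| / 2)))
      ≤ ((2 * π / Real.log p) ^ (-(1 / 2 : ℝ)) * Real.sqrt 2 * (|(n : ℝ)| + 1) ^ (-(1 / 2 : ℝ))) *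
          Real.sqrt (2 * π * K) :=
        mul_le_mul hpow hsq (Real.sqrt_nonneg _) (by positivity)
    _ = (2 * π / Real.log p) ^ (-(1 / 2 : ℝ)) * Real.sqrt 2 * Real.sqrt (2 * π * K) *
          (|(n : ℝ)| + 1) ^ (-(1 / 2 : ℝ)) := by ring

end Decay

/-! ### D. Theorem 4.4 (i) -/

section TheoremFourFourOne

/-- RH-FREE. The boundary function `κκ_p|S¹` is in `L^∞(S¹)`, and its `L^∞` class is a.e. the function
(private copy of the lemma of `QuasiInnerProductSymbol.lean`). [folklore] -/
private theorem po_memLp_kappaProduct {p : ℕ} (hp : 1 < p) :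
    MemLp (circleRestrict 1 fun v => kappaArch v * kappaPrime p v) ∞ (haarAddCircle (T := 1)) ∧
      ((toLpOrZero ∞ haarAddCircle (circleRestrict 1 fun v => kappaArch v * kappaPrime p v) :
          Lp ℂ ∞ (haarAddCircle (T := 1))) : AddCircle (1 : ℝ) → ℂ) =ᵐ[haarAddCircle (T := 1)]
        circleRestrict 1 fun v => kappaArch v * kappaPrime p v := by
  obtain ⟨h1, -, -⟩ := memLp_circleRestrict_kappaArch
  obtain ⟨h2, -, -⟩ := memLp_circleRestrict_kappaPrime hp
  have heq : (circleRestrict 1 fun v => kappaArch v * kappaPrime p v) =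
      fun x => circleRestrict 1 kappaArch x * circleRestrict 1 (kappaPrime p) x := rfl
  have hmem : MemLp (circleRestrict 1 fun v => kappaArch v * kappaPrime p v) ∞ (haarAddCircle (T := 1)) := by
    rw [heq]
    refine memLp_top_of_bound (h1.aestronglyMeasurable.mul h2.aestronglyMeasurable) 1
      (ae_of_all _ fun x => ?_)
    rw [norm_mul, norm_circleRestrict_kappaArch 1 x, norm_circleRestrict_kappaPrime (T := 1) hp x, mul_one]
  refine ⟨hmem, ?_⟩
  rw [toLpOrZero_eq_toLp hmem]
  exact hmem.coeFn_toLp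

/-- RH-FREE. The coefficients of eq. (4.3) decay factorially with every polynomial weight:
`Σ_n |c^{(p)}_{n+1}|(n+1)^k < ∞` (`|c^{(p)}_n| ≤ |c_n| ≤ 4√π π^{2n}/n!`, g1's `abs_thm23Coeff_le`, and
`(n+1)^k ≤ 2^{k(n+1)}`). [cite: ConnesConsani2021QuasiInner, Thm 4.4 (ii) eq. (4.3) (arXiv chunk p0011:L93) with Thm 2.3 (p0006:L49)] -/
private theorem po_summable_thm44Coeff_weight {p : ℕ} (hp : 2 ≤ p) (k : ℕ) :
    Summable fun n : ℕ => ‖(thm44Coeff p (n + 1) : ℂ)‖ * ((n : ℝ) + 1) ^ k := by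
  -- `|c^{(p)}_n| ≤ |c_n|`
  have hle1 : ∀ n : ℕ, |thm44Coeff p (n + 1)| ≤ 4 * Real.sqrt π * (π ^ 2) ^ (n + 1) / ((n + 1)! : ℝ) := by
    intro n
    have hp1 : (1 : ℝ) < (p : ℝ) ^ (2 * (n + 1)) := one_lt_pow₀ (by exact_mod_cast hp) (by omega)
    have hp2 : (1 : ℝ) < (p : ℝ) ^ (2 * (n + 1) + 1) := one_lt_pow₀ (by exact_mod_cast hp) (by omega)
    rw [thm44Coeff_eq_thm23Coeff_mul hp (by omega : 1 ≤ n + 1), abs_mul]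
    have hp4 : (4 : ℝ) ≤ (p : ℝ) ^ (2 * (n + 1)) :=
      calc (4 : ℝ) = 2 ^ 2 := by norm_num
        _ ≤ (2 : ℝ) ^ (2 * (n + 1)) := pow_le_pow_right₀ (by norm_num) (by omega)
        _ ≤ (p : ℝ) ^ (2 * (n + 1)) := pow_le_pow_left₀ (by norm_num) (by exact_mod_cast hp) _
    have hfac : |(1 - ((p : ℝ) ^ (2 * (n + 1) + 1))⁻¹) / (1 - (p : ℝ) ^ (2 * (n + 1)))| ≤ 1 := by
      rw [abs_div, div_le_one (abs_pos.2 (by linarith))]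
      rw [abs_of_nonneg (by rw [sub_nonneg]; exact inv_le_one_of_one_le₀ hp2.le),
        abs_of_neg (by linarith)]
      have : 0 < ((p : ℝ) ^ (2 * (n + 1) + 1))⁻¹ := by positivity
      linarith
    calc |thm23Coeff (n + 1)| * |(1 - ((p : ℝ) ^ (2 * (n + 1) + 1))⁻¹) / (1 - (p : ℝ) ^ (2 * (n + 1)))|
        ≤ (4 * Real.sqrt π * (π ^ 2) ^ (n + 1) / ((n + 1)! : ℝ)) * 1 :=
          mul_le_mul (abs_thm23Coeff_le (n + 1)) hfac (abs_nonneg _) (by positivity)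
      _ = _ := mul_one _
  -- majorant `4√π (2^k π²)^{n+1}/(n+1)!`
  have hmaj : Summable fun n : ℕ =>
      4 * Real.sqrt π * ((2 : ℝ) ^ k * π ^ 2) ^ (n + 1) / ((n + 1)! : ℝ) := by
    have h0 := Real.summable_pow_div_factorial ((2 : ℝ) ^ k * π ^ 2)
    have h1 : Summable fun n : ℕ => ((2 : ℝ) ^ k * π ^ 2) ^ (n + 1) / ((n + 1)! : ℝ) :=
      (summable_nat_add_iff 1).2 h0
    refine (h1.mul_left (4 * Real.sqrt π)).congr fun n => ?_
    ring
  refine Summable.of_nonneg_of_le (fun n => by positivity) (fun n => ?_) hmaj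
  rw [Complex.norm_real, Real.norm_eq_abs]
  have hnk : ((n : ℝ) + 1) ^ k ≤ ((2 : ℝ) ^ k) ^ (n + 1) := by
    have h1 : (n : ℝ) + 1 ≤ (2 : ℝ) ^ (n + 1) := by
      have := Nat.lt_two_pow_self (n := n + 1)
      exact_mod_cast this.le
    calc ((n : ℝ) + 1) ^ k ≤ ((2 : ℝ) ^ (n + 1)) ^ k := pow_le_pow_left₀ (by positivity) h1 k
      _ = ((2 : ℝ) ^ k) ^ (n + 1) := by rw [← pow_mul, ← pow_mul, mul_comm]
  calc |thm44Coeff p (n + 1)| * ((n : ℝ) + 1) ^ k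
      ≤ (4 * Real.sqrt π * (π ^ 2) ^ (n + 1) / ((n + 1)! : ℝ)) * ((2 : ℝ) ^ k) ^ (n + 1) :=
        mul_le_mul (hle1 n) hnk (by positivity) (by positivity)
    _ = 4 * Real.sqrt π * ((2 : ℝ) ^ k * π ^ 2) ^ (n + 1) / ((n + 1)! : ℝ) := by
        rw [mul_pow]; ring

/-- RH-FREE. A normalized vector has norm `≤ 1`. [folklore] -/
private theorem po_norm_unit_le (v : Lp ℂ 2 (haarAddCircle (T := (1 : ℝ)))) :
    ‖((‖v‖ : ℂ)⁻¹) • v‖ ≤ 1 := by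
  rw [norm_smul, norm_inv, Complex.norm_real, Real.norm_eq_abs, abs_norm]
  exact inv_mul_le_one

/-- RH-FREE. **Theorem 4.4 (i) PROVED**: «The function `ρ_∞(z)ρ_p(z)` is quasi-inner relative to the upper
half plane [sic: relative to `ℂ_−`]. The off diagonal part is an infinitesimal of order `½`.» — for every
prime `p`, in the typing of t18's conditional `thm_4_4_i` (`IsQuasiInnerLeftHalfPlane`, Connes' order
`IsInfinitesimalOfOrder … (1/2)` of `(1 − 𝒫)κκ_p𝒫`), now WITHOUT the hypothesis `thm_4_8`.
[cite: ConnesConsani2021QuasiInner, Thm 4.4 (i) (arXiv chunk p0011:L89; proof p0012:L19–L21)] -/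
theorem thm_4_4_i_unconditional (p : Nat.Primes) :
    IsQuasiInnerLeftHalfPlane (fun z => rhoArch z * rhoPrime (p : ℕ) z) ∧
      IsInfinitesimalOfOrder
        (hardyOffDiag 1 (toLpOrZero ∞ haarAddCircle
          (circleRestrict 1 fun v => kappaArch v * kappaPrime (p : ℕ) v)))
        (1 / 2) := by
  have hp : (p : ℕ).Prime := p.2
  have hp1 : 1 < (p : ℕ) := hp.one_lt
  have h12 : (0 : ℝ) ≤ 1 / 2 := by norm_num
  -- the operators `V`, `I`, `D`
  obtain ⟨B, hB, -⟩ := (lemma_3_3_holds p hp).1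
  obtain ⟨V, U, hV, -, -, -⟩ := lemma_3_4_holds p hp B hB
  obtain ⟨Iop, hI⟩ := exists_lpInvolution
  obtain ⟨C₁, hC₁⟩ := exists_norm_rhoArch_primePole_le hp1
  set d : ℤ → ℂ := fun n => if n = 0 then 0 else rhoArch (2 * π * I * n / Real.log p) with hd
  have hd' : ∀ n : ℤ, ‖d n‖ ≤ max C₁ 0 * ((|n| : ℝ) + 1) ^ (-(1 / 2 : ℝ)) := by
    intro n
    by_cases hn : n = 0
    · have h0 : d n = 0 := by rw [hd]; simp only [hn, if_true]
      rw [h0, norm_zero]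
      exact mul_nonneg (le_max_right _ _) (Real.rpow_nonneg (by positivity) _)
    · have h1 : d n = rhoArch (2 * π * I * n / Real.log p) := by rw [hd]; simp only [hn, if_false]
      rw [h1]
      exact (hC₁ n hn).trans
        (mul_le_mul_of_nonneg_right (le_max_left _ _) (Real.rpow_nonneg (by positivity) _))
  have hdb : ∀ n : ℤ, ‖d n‖ ≤ max C₁ 0 := by
    intro n
    refine (hd' n).trans (mul_le_of_le_one_right (le_max_right _ _) ?_)
    exact Real.rpow_le_one_of_one_le_of_nonpos (by linarith [abs_nonneg (n : ℝ)]) (by norm_num)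
  obtain ⟨Dop, hDop⟩ := exists_lpDiagonal hdb
  have hD0 : Dop (lp.single 2 0 (1 : ℂ)) = 0 := by
    have h0 : d 0 = 0 := by rw [hd]; simp only [if_true]
    rw [hDop, h0, zero_smul]
  have hD : ∀ n : ℤ, n ≠ 0 →
      Dop (lp.single 2 n (1 : ℂ)) = rhoArch (2 * π * I * n / Real.log p) • lp.single 2 n (1 : ℂ) := by
    intro n hn
    have h1 : d n = rhoArch (2 * π * I * n / Real.log p) := by rw [hd]; simp only [hn, if_false]
    rw [hDop, h1]
  -- Theorem 4.4 (ii)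
  obtain ⟨Einf, E0, hEsum, hfin, heq⟩ := thm_4_4_ii_holds p hp V Iop Dop hV hI hD0 hD
  -- the three orders
  have hEinf : IsInfinitesimalOfOrder Einf (1 / 2) := by
    have hinf : IsInfiniteOrder Einf :=
      isInfiniteOrder_of_hasSum_rankOne (c := fun n : ℕ => (thm44Coeff p (n + 1) : ℂ))
        (x := fun n : ℕ => ((‖xiVec 1 (xArch (n + 1) : ℂ)‖ : ℂ)⁻¹) • xiVec 1 (xArch (n + 1) : ℂ))
        (y := fun n : ℕ => ((‖etaVec 1 (xArch (n + 1) : ℂ)‖ : ℂ)⁻¹) • etaVec 1 (xArch (n + 1) : ℂ))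
        (fun n => po_norm_unit_le _) (fun n => po_norm_unit_le _)
        (po_summable_thm44Coeff_weight hp.two_le) hEsum
    exact (((isInfiniteOrder_iff Einf).1 hinf) 1).of_le (by norm_num)
  have hDord : IsInfinitesimalOfOrder Dop (1 / 2) := isInfinitesimalOfOrder_of_diag hDop h12 hd'
  have hM : IsInfinitesimalOfOrder ((((1 - ((p : ℕ) : ℝ)) / (p : ℕ) : ℝ) : ℂ) •
      ((hardyIsoMinus 1).toContinuousLinearMap ∘L V ∘L Dop ∘L Iop ∘L (ContinuousLinearMap.adjoint V) ∘L
        ContinuousLinearMap.adjoint (hardyIsoPlus 1).toContinuousLinearMap :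
        Lp ℂ 2 (haarAddCircle (T := (1 : ℝ))) →L[ℂ] Lp ℂ 2 (haarAddCircle (T := (1 : ℝ))))) (1 / 2) := by
    refine po_order_smul ?_ _
    have h := po_order_conj hDord ((hardyIsoMinus 1).toContinuousLinearMap ∘L V)
      (Iop ∘L (ContinuousLinearMap.adjoint V) ∘L
        ContinuousLinearMap.adjoint (hardyIsoPlus 1).toContinuousLinearMap)
    rwa [ContinuousLinearMap.comp_assoc] at h
  have hE0 : IsInfinitesimalOfOrder E0 (1 / 2) := by
    haveI := hfin
    exact isInfinitesimalOfOrder_of_rank_le (le_of_eq (Module.finrank_eq_rank ℂ _).symm) _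
  have hord : IsInfinitesimalOfOrder (hardyOffDiag 1 (toLpOrZero ∞ haarAddCircle
      (circleRestrict 1 fun v => kappaArch v * kappaPrime (p : ℕ) v))) (1 / 2) := by
    rw [heq]
    exact (hEinf.add h12 hM).add h12 hE0
  refine ⟨?_, hord⟩
  -- quasi-inner
  have hk : circleRestrict 1 ((fun z => rhoArch z * rhoPrime (p : ℕ) z) ∘ cayley) =
      circleRestrict 1 fun v => kappaArch v * kappaPrime (p : ℕ) v := rfl
  obtain ⟨hmem, hae⟩ := po_memLp_kappaProduct hp1
  refine ⟨hk ▸ hmem, ?_, ?_⟩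
  · rw [hk]
    filter_upwards [hae] with x hx
    rw [hx]
    calc ‖circleRestrict 1 (fun v => kappaArch v * kappaPrime (p : ℕ) v) x‖
        = ‖circleRestrict 1 kappaArch x‖ * ‖circleRestrict 1 (kappaPrime (p : ℕ)) x‖ := norm_mul _ _
      _ = 1 := by
          rw [norm_circleRestrict_kappaArch 1 x, norm_circleRestrict_kappaPrime (T := 1) hp1 x, mul_one]
  · rw [hk]
    exact isCompactOperator_of_isInfinitesimalOfOrder (by norm_num) hord

end TheoremFourFourOne

/-! ### E. Append #1 — inputs for Theorem 4.8: the factor `ρ_∞^{(m,k)}` alone -/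

section FactorInfiniteOrder

/-- RH-FREE. **Two-sided ideal across two spaces** (public form of the private lemma above): `A ∘ T ∘ B` is
of order `α` on `F` when `T` is of order `α` on `E`, for bounded `A : E → F`, `B : F → E`
(`μ_n(ATB) ≤ ‖A‖μ_n(T)‖B‖`). [cite: Connes1994, Introduction, quantized-calculus dictionary («they form a two-sided ideal»)] -/
theorem _root_.Literature.NumberTheory.ConnesConsani2021.IsInfinitesimalOfOrder.conj {E F : Type}
    [NormedAddCommGroup E] [NormedSpace ℂ E] [NormedAddCommGroup F] [NormedSpace ℂ F]
    {T : E →L[ℂ] E} {α : ℝ} (h : IsInfinitesimalOfOrder T α) (A : E →L[ℂ] F) (B : F →L[ℂ] E) :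
    IsInfinitesimalOfOrder (A ∘L T ∘L B) α :=
  po_order_conj h A B

variable {H : Type*} [NormedAddCommGroup H] [InnerProductSpace ℂ H] [CompleteSpace H]

/-- RH-FREE. **Weighted form of `isInfiniteOrder_of_hasSum_rankOne`**: if `T = Σ_n c_n|x_n⟩⟨y_n|` with
`Σ_n |c_n|‖x_n‖‖y_n‖(n+1)^k < ∞` for every `k`, then `T` is of infinite order (the same tail estimate,
`‖c_n|x_n⟩⟨y_n|‖ = |c_n|‖x_n‖‖y_n‖`). [cite: ConnesConsani2021QuasiInner, Thm 2.1 proof (arXiv chunk p0005:L128–L136)] -/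
theorem isInfiniteOrder_of_hasSum_rankOne' {c : ℕ → ℂ} {x y : ℕ → H}
    (hc : ∀ k : ℕ, Summable fun n => ‖c n‖ * ‖x n‖ * ‖y n‖ * ((n : ℝ) + 1) ^ k)
    {T : H →L[ℂ] H} (hT : HasSum (fun n => c n • InnerProductSpace.rankOne ℂ (x n) (y n)) T) :
    IsInfiniteOrder T := by
  refine IsInfiniteOrder.of_approx fun k => ⟨∑' n, ‖c n‖ * ‖x n‖ * ‖y n‖ * ((n : ℝ) + 1) ^ k, fun N => ?_⟩
  refine ⟨∑ n ∈ Finset.range N, c n • InnerProductSpace.rankOne ℂ (x n) (y n),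
    (po_rank_sum_rankOne_le _ c x y).trans (by rw [Finset.card_range]), ?_⟩
  have hNpos : (0 : ℝ) < (N : ℝ) + 1 := by positivity
  have htail : HasSum (fun n => c (n + N) • InnerProductSpace.rankOne ℂ (x (n + N)) (y (n + N)))
      (T - ∑ n ∈ Finset.range N, c n • InnerProductSpace.rankOne ℂ (x n) (y n)) :=
    (hasSum_nat_add_iff' N).2 hT
  have hck := hc k
  set w : ℕ → ℝ := fun n => ‖c n‖ * ‖x n‖ * ‖y n‖ * ((n : ℝ) + 1) ^ k with hw
  have hshift : Summable fun n => w (n + N) := (summable_nat_add_iff N).2 hck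
  set g : ℕ → ℝ := fun n => w (n + N) / ((N : ℝ) + 1) ^ k with hg
  have hgsum : HasSum g ((∑' n, w (n + N)) / ((N : ℝ) + 1) ^ k) := hshift.hasSum.div_const _
  have hle : ∀ n, ‖c (n + N) • InnerProductSpace.rankOne ℂ (x (n + N)) (y (n + N))‖ ≤ g n := by
    intro n
    rw [norm_smul, InnerProductSpace.norm_rankOne, hg, hw]
    dsimp only
    have h2 : (1 : ℝ) ≤ (((n + N : ℕ) : ℝ) + 1) ^ k / ((N : ℝ) + 1) ^ k := by
      rw [le_div_iff₀ (by positivity), one_mul]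
      exact pow_le_pow_left₀ hNpos.le (by push_cast; linarith [(n.cast_nonneg : (0 : ℝ) ≤ n)]) k
    have h0 : 0 ≤ ‖c (n + N)‖ * (‖x (n + N)‖ * ‖y (n + N)‖) := by positivity
    calc ‖c (n + N)‖ * (‖x (n + N)‖ * ‖y (n + N)‖) = ‖c (n + N)‖ * (‖x (n + N)‖ * ‖y (n + N)‖) * 1 :=
          (mul_one _).symm
      _ ≤ ‖c (n + N)‖ * (‖x (n + N)‖ * ‖y (n + N)‖) * ((((n + N : ℕ) : ℝ) + 1) ^ k / ((N : ℝ) + 1) ^ k) :=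
          mul_le_mul_of_nonneg_left h2 h0
      _ = ‖c (n + N)‖ * ‖x (n + N)‖ * ‖y (n + N)‖ * (((n + N : ℕ) : ℝ) + 1) ^ k / ((N : ℝ) + 1) ^ k := by
          ring
  have hnorm := htail.norm_le_of_bounded hgsum hle
  have htail_le : (∑' n, w (n + N)) ≤ ∑' n, w n := by
    have h := hck.sum_add_tsum_nat_add N
    have h0 : 0 ≤ ∑ i ∈ Finset.range N, w i := Finset.sum_nonneg fun i _ => by rw [hw]; positivity
    linarith [h]
  calc ‖T - ∑ n ∈ Finset.range N, c n • InnerProductSpace.rankOne ℂ (x n) (y n)‖ * ((N : ℝ) + 1) ^ k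
      ≤ (∑' n, w (n + N)) / ((N : ℝ) + 1) ^ k * ((N : ℝ) + 1) ^ k :=
        mul_le_mul_of_nonneg_right hnorm (by positivity)
    _ = ∑' n, w (n + N) := by field_simp
    _ ≤ ∑' n, w n := htail_le

/-- RH-FREE. The geometry of the poles in the disk: for `p = −q`, `q ≥ 0`, `x = ψ⁻¹(p) = (2p+1)/(2p−3)`
satisfies `|x| ≤ 1 − 2/(2q+3)` and `|2p − 3| = 2q + 3`. [folklore] -/
private theorem po_pole_geometry {q : ℝ} (hq : 0 ≤ q) :
    ‖(2 * (-((q : ℝ) : ℂ)) + 1) / (2 * (-((q : ℝ) : ℂ)) - 3)‖ ≤ 1 - 2 / (2 * q + 3) ∧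
      ‖2 * (-((q : ℝ) : ℂ)) - 3‖ = 2 * q + 3 := by
  have h3 : 2 * (-((q : ℝ) : ℂ)) - 3 = (((-(2 * q + 3) : ℝ)) : ℂ) := by push_cast; ring
  have h1 : 2 * (-((q : ℝ) : ℂ)) + 1 = (((-(2 * q - 1) : ℝ)) : ℂ) := by push_cast; ring
  have hpos : 0 < 2 * q + 3 := by linarith
  rw [h3, h1, norm_div, Complex.norm_real, Complex.norm_real, Real.norm_eq_abs, Real.norm_eq_abs, abs_neg,
    abs_neg, abs_of_pos hpos]
  refine ⟨?_, rfl⟩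
  rw [div_le_iff₀ hpos, show (1 - 2 / (2 * q + 3)) * (2 * q + 3) = 2 * q + 1 by field_simp; ring]
  exact abs_le.2 ⟨by linarith, by linarith⟩

/-- RH-FREE. **The Hankel data of `κ^{(m,k)} = ρ_∞^{(m,k)} ∘ ψ`** (`0 ≤ k < m`): real nodes `x_n = ψ⁻¹(−2k−2mn)`
in the disk and coefficients `c_n = −8r_n/(2(−2k−2mn)−3)²` (`r_n` the residue of `ρ_∞^{(m,k)}` at `−2k−2mn`)
with `κ^{(m,k)}^(−ℓ−1) = Σ_n c_n x_n^ℓ` for every `ℓ ≥ 0`, and `Σ_n |c_n|(1−|x_n|)⁻¹(n+1)^K < ∞` for every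
`K` («The residues at these poles decay extremely fast to `0` as in the case of `ρ_∞`. Thus the results of
Section 2 continue to hold», Lemma 4.7). [cite: ConnesConsani2021QuasiInner, Lemma 4.7 proof (arXiv chunk p0014:L56) with Thm 2.3 proof (p0006:L59–L68)] -/
theorem exists_hankelData_rhoFactor {m : ℕ} (hm : 0 < m) {k : ℕ} (hk : k < m) :
    ∃ x c : ℕ → ℂ, (∀ n, ‖x n‖ < 1) ∧ (∀ n, (x n).im = 0) ∧
      (∀ K : ℕ, Summable fun n => ‖c n‖ * (1 - ‖x n‖)⁻¹ * ((n : ℝ) + 1) ^ K) ∧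
      ∀ ℓ : ℕ, HasSum (fun n => c n * x n ^ ℓ)
        (fourierCoeff (T := 1) ((toLpOrZero ∞ haarAddCircle (circleRestrict 1 (rhoFactor m k ∘ cayley)) :
          Lp ℂ ∞ (haarAddCircle (T := 1))) : AddCircle (1:ℝ) → ℂ) (-(ℓ + 1 : ℤ))) := by
  have hm0 : (0 : ℝ) < m := Nat.cast_pos.mpr hm
  have hmem := memLp_circleRestrict_rhoFactor hm k
  have hae : ((toLpOrZero ∞ haarAddCircle (circleRestrict 1 (rhoFactor m k ∘ cayley)) :
      Lp ℂ ∞ (haarAddCircle (T := 1))) : AddCircle (1:ℝ) → ℂ) =ᵐ[haarAddCircle (T := 1)]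
      circleRestrict 1 (rhoFactor m k ∘ cayley) := by
    rw [toLpOrZero_eq_toLp hmem]
    exact hmem.coeFn_toLp
  -- the poles `p_n = −2k − 2mn`, their residues `E n`
  set P : ℕ → ℂ := fun n => -(2 * (k : ℂ) + 2 * (m : ℂ) * (n : ℂ)) with hP
  set E : ℕ → ℂ := fun n => 2 * (m : ℂ) * ((π : ℂ) / m) ^ (1 / (2 * (m : ℂ)) - P n / m) *
    (Complex.Gamma ((1 - P n) / (2 * (m : ℂ)) + (k : ℂ) / (m : ℂ)))⁻¹ / ((-1) ^ n * (n ! : ℂ)) with hE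
  have hpole : ∀ n : ℕ, ∃ Φ : ℂ → ℂ, DifferentiableOn ℂ Φ (Metric.ball (P n) 1) ∧ Φ (P n) = E n ∧
      ∀ z ∈ Metric.ball (P n) 1, z ≠ P n → rhoFactor m k z = Φ z / (z - P n) :=
    fun n => exists_rhoFactor_eq_div_sub_pole hm k n
  set C₀ : ℝ := 2 * (m : ℝ) * (π / m) ^ ((1 + 4 * k) / (2 * m) : ℝ) with hC₀
  have hEle : ∀ n : ℕ, 2 ≤ n → ‖E n‖ ≤ C₀ * ((π / m) ^ 2) ^ n / n ! := fun n hn =>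
    norm_rhoFactor_residue_le hm k hn
  have hEs : Summable fun n : ℕ => ‖E n‖ := by
    have hmaj : Summable fun n : ℕ => C₀ * ((π / m) ^ 2) ^ n / n ! := by
      have := (Real.summable_pow_div_factorial ((π / m) ^ 2)).mul_left C₀
      refine this.congr fun n => ?_
      ring
    refine Summable.of_norm_bounded_eventually hmaj ?_
    rw [Nat.cofinite_eq_atTop]
    filter_upwards [eventually_ge_atTop 2] with n hn
    rw [Real.norm_eq_abs, abs_norm]
    exact hEle n hn
  have hPq : ∀ n : ℕ, P n = -(((2 * k + 2 * m * n : ℝ)) : ℂ) := by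
    intro n; simp only [hP]; push_cast; ring
  have hq : ∀ n : ℕ, (0 : ℝ) ≤ 2 * k + 2 * m * n := fun n => by positivity
  have hx : ∀ n : ℕ, ‖(2 * P n + 1) / (2 * P n - 3)‖ < 1 := by
    intro n
    rw [hPq]
    refine ((po_pole_geometry (hq n)).1).trans_lt ?_
    have : 0 < 2 / (2 * (2 * (k : ℝ) + 2 * m * n) + 3) := by positivity
    linarith
  have him : ∀ n : ℕ, ((2 * P n + 1) / (2 * P n - 3)).im = 0 := by
    intro n
    rw [hPq, show (2 * -((((2 * k + 2 * m * n : ℝ)) : ℂ)) + 1) / (2 * -((((2 * k + 2 * m * n : ℝ)) : ℂ)) - 3) =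
      ((((2 * -(2 * k + 2 * m * n) + 1) / (2 * -(2 * k + 2 * m * n) - 3) : ℝ)) : ℂ) by push_cast; ring]
    exact ofReal_im _
  -- the weighted bound `|c_n|(1 − |x_n|)⁻¹ ≤ (4/3)|E n|`
  have hcw : ∀ n : ℕ, ‖-8 * E n / (2 * P n - 3) ^ 2‖ * (1 - ‖(2 * P n + 1) / (2 * P n - 3)‖)⁻¹ ≤
      4 / 3 * ‖E n‖ := by
    intro n
    obtain ⟨hxle, h3⟩ := po_pole_geometry (hq n)
    rw [← hPq] at hxle h3
    have hpos : (0 : ℝ) < 2 * (2 * k + 2 * m * n) + 3 := by positivity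
    have hcn : ‖-8 * E n / (2 * P n - 3) ^ 2‖ = 8 * ‖E n‖ / (2 * (2 * k + 2 * m * n) + 3) ^ 2 := by
      rw [norm_div, norm_mul, norm_neg, norm_pow, h3]
      norm_num
    have hinv : (1 - ‖(2 * P n + 1) / (2 * P n - 3)‖)⁻¹ ≤ (2 * (2 * k + 2 * m * n) + 3) / 2 := by
      rw [show (2 * (2 * (k : ℝ) + 2 * m * n) + 3) / 2 = (2 / (2 * (2 * (k : ℝ) + 2 * m * n) + 3))⁻¹ by
        rw [inv_div]]
      exact inv_anti₀ (by positivity) (by linarith)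
    calc ‖-8 * E n / (2 * P n - 3) ^ 2‖ * (1 - ‖(2 * P n + 1) / (2 * P n - 3)‖)⁻¹
        ≤ 8 * ‖E n‖ / (2 * (2 * k + 2 * m * n) + 3) ^ 2 * ((2 * (2 * k + 2 * m * n) + 3) / 2) :=
          mul_le_mul hcn.le hinv (inv_nonneg.mpr (by linarith [hx n])) (by positivity)
      _ = 4 * ‖E n‖ / (2 * (2 * k + 2 * m * n) + 3) := by
          field_simp
          ring
      _ ≤ 4 / 3 * ‖E n‖ := by
          rw [div_le_iff₀ hpos]
          nlinarith [mul_nonneg (hq n) (norm_nonneg (E n))]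
  refine ⟨fun n => (2 * P n + 1) / (2 * P n - 3), fun n => -8 * E n / (2 * P n - 3) ^ 2, hx, him, ?_, ?_⟩
  · -- polynomially weighted summability from the factorial decay of `E n`
    intro K
    have hmaj : Summable fun n : ℕ => 4 / 3 * (C₀ * ((2 : ℝ) ^ K) * (((2 : ℝ) ^ K * (π / m) ^ 2) ^ n / n !)) := by
      have := ((Real.summable_pow_div_factorial ((2 : ℝ) ^ K * (π / m) ^ 2)).mul_left
        (C₀ * (2 : ℝ) ^ K)).mul_left (4 / 3)
      refine this.congr fun n => ?_
      ring
    refine Summable.of_norm_bounded_eventually hmaj ?_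
    rw [Nat.cofinite_eq_atTop]
    filter_upwards [eventually_ge_atTop 2] with n hn
    rw [Real.norm_eq_abs, abs_of_nonneg (by
      have := hx n
      exact mul_nonneg (mul_nonneg (norm_nonneg _) (inv_nonneg.2 (by linarith))) (by positivity))]
    have hnk : ((n : ℝ) + 1) ^ K ≤ (2 : ℝ) ^ K * ((2 : ℝ) ^ K) ^ n := by
      have h1 : (n : ℝ) + 1 ≤ (2 : ℝ) ^ (n + 1) := by
        have := Nat.lt_two_pow_self (n := n + 1)
        exact_mod_cast this.le
      calc ((n : ℝ) + 1) ^ K ≤ ((2 : ℝ) ^ (n + 1)) ^ K := pow_le_pow_left₀ (by positivity) h1 K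
        _ = (2 : ℝ) ^ K * ((2 : ℝ) ^ K) ^ n := by rw [← pow_mul, ← pow_mul, ← pow_add]; ring_nf
    calc ‖-8 * E n / (2 * P n - 3) ^ 2‖ * (1 - ‖(2 * P n + 1) / (2 * P n - 3)‖)⁻¹ * ((n : ℝ) + 1) ^ K
        ≤ (4 / 3 * ‖E n‖) * ((2 : ℝ) ^ K * ((2 : ℝ) ^ K) ^ n) :=
          mul_le_mul (hcw n) hnk (by positivity) (by positivity)
      _ ≤ (4 / 3 * (C₀ * ((π / m) ^ 2) ^ n / n !)) * ((2 : ℝ) ^ K * ((2 : ℝ) ^ K) ^ n) := by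
          gcongr
          exact hEle n hn
      _ = 4 / 3 * (C₀ * ((2 : ℝ) ^ K) * (((2 : ℝ) ^ K * (π / m) ^ 2) ^ n / n !)) := by
          rw [mul_pow]; ring
  · intro ℓ
    have h := hasSum_fourierCoeff_rhoFactor hm hk E hpole hEs ℓ
    have e : (-((ℓ + 1 : ℕ) : ℤ)) = -(ℓ + 1 : ℤ) := by push_cast; ring
    rw [e] at h
    have hcongr : fourierCoeff (T := 1) ((toLpOrZero ∞ haarAddCircle (circleRestrict 1 (rhoFactor m k ∘ cayley)) :
        Lp ℂ ∞ (haarAddCircle (T := 1))) : AddCircle (1:ℝ) → ℂ) (-(ℓ + 1 : ℤ)) =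
        fourierCoeff (T := 1) (circleRestrict 1 (rhoFactor m k ∘ cayley)) (-(ℓ + 1 : ℤ)) := by
      simp only [fourierCoeff]
      exact integral_congr_ae (by filter_upwards [hae] with y hy; simp only [hy])
    rw [hcongr]
    exact h

/-- RH-FREE. **`(1 − 𝒫)κ^{(m,k)}𝒫 = Σ_n c_n|ξ_{x_n}⟩⟨η_{x_n}|`**, norm-convergent, for the Hankel data of
`exists_hankelData_rhoFactor` (Theorem 2.3 run for the factor `ρ_∞^{(m,k)}`, Lemma 4.7).
[cite: ConnesConsani2021QuasiInner, Lemma 4.7 proof (arXiv chunk p0014:L56) with Thm 2.3 (p0006:L49–L68)] -/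
theorem hasSum_hardyOffDiag_rhoFactor {m : ℕ} (hm : 0 < m) {k : ℕ} (hk : k < m) :
    ∃ x c : ℕ → ℂ, (∀ n, ‖x n‖ < 1) ∧ (∀ n, (x n).im = 0) ∧
      (∀ K : ℕ, Summable fun n => ‖c n‖ * (1 - ‖x n‖)⁻¹ * ((n : ℝ) + 1) ^ K) ∧
      HasSum (fun n => c n • InnerProductSpace.rankOne ℂ (xiVec 1 (x n)) (etaVec 1 (x n)))
        (hardyOffDiag 1 (toLpOrZero ∞ haarAddCircle (circleRestrict 1 (rhoFactor m k ∘ cayley)))) := by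
  obtain ⟨x, c, hx, him, hsum, hcoef⟩ := exists_hankelData_rhoFactor hm hk
  refine ⟨x, c, hx, him, hsum, ?_⟩
  have hs : Summable fun n => ‖c n‖ * (1 - ‖x n‖)⁻¹ := by
    refine (hsum 0).congr fun n => ?_
    rw [pow_zero, mul_one]
  exact hasSum_hardyOffDiag_of_hasSum_fourierCoeff _ hx hs hcoef

/-- RH-FREE. **`(1 − 𝒫)κ^{(m,k)}𝒫` is an infinitesimal of infinite order** (`0 ≤ k < m`): «the residues at
these poles decay extremely fast to `0` as in the case of `ρ_∞`. Thus the results of Section 2 continue to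
hold» — Theorem 2.1's second sentence for the factor `ρ_∞^{(m,k)}`.
[cite: ConnesConsani2021QuasiInner, Lemma 4.7 proof (arXiv chunk p0014:L56) with Thm 2.1 (p0005:L124–L136)] -/
theorem isInfiniteOrder_hardyOffDiag_rhoFactor {m : ℕ} (hm : 0 < m) {k : ℕ} (hk : k < m) :
    IsInfiniteOrder (hardyOffDiag 1 (toLpOrZero ∞ haarAddCircle (circleRestrict 1 (rhoFactor m k ∘ cayley)))) := by
  obtain ⟨x, c, hx, -, hsum, h⟩ := hasSum_hardyOffDiag_rhoFactor hm hk
  refine isInfiniteOrder_of_hasSum_rankOne' (fun K => ?_) h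
  refine Summable.of_nonneg_of_le (fun n => by positivity) (fun n => ?_) (hsum K)
  have hx1 := hx n
  have h1 : 0 < 1 - ‖x n‖ := by linarith
  rw [mul_assoc ‖c n‖, norm_xiVec_mul_norm_etaVec (T := 1) (x n) hx1]
  have hle : (1 - ‖x n‖ ^ 2)⁻¹ ≤ (1 - ‖x n‖)⁻¹ := by
    refine inv_anti₀ h1 ?_
    nlinarith [norm_nonneg (x n)]
  have h0 : 0 ≤ ‖c n‖ * ((n : ℝ) + 1) ^ K := by positivity
  calc ‖c n‖ * (1 - ‖x n‖ ^ 2)⁻¹ * ((n : ℝ) + 1) ^ K = (1 - ‖x n‖ ^ 2)⁻¹ * (‖c n‖ * ((n : ℝ) + 1) ^ K) := by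
        ring
    _ ≤ (1 - ‖x n‖)⁻¹ * (‖c n‖ * ((n : ℝ) + 1) ^ K) := mul_le_mul_of_nonneg_right hle h0
    _ = ‖c n‖ * (1 - ‖x n‖)⁻¹ * ((n : ℝ) + 1) ^ K := by ring

end FactorInfiniteOrder

end QuasiInner

end Literature.NumberTheory.ConnesConsani2021
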